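import Literature.MathematicalPhysics.QuantumFieldTheory.Balaban1983to89.B9Cor36SiteSandwichTransfer
import Literature.MathematicalPhysics.QuantumFieldTheory.Balaban1983to89.B9SectBAllBlocksGeometryY

/-!
# `Balaban1983to89.B9Cor36SiteSandwichTransferBlocks` — [Balaban1985BackgroundPropagators] COROLLARY 3.6 p. 408 / THEOREM 3.7 p. 409 BOOKKEEPING, SITE SECTOR,
# ALL-BLOCKS READING: a [4]-(2.51) block majorant of a SITE-SECTOR operator over the CUBE SEQUENCE's blocks, sandwiched between a bi-contractive gauge
# rotation `R(u)⁻¹ … R(u)` and two scalar cut-offs `M_{g₁} … M_{g₂}` (the right one supported near □), IS a block majorant over ALL THE MEMBER's BLOCKS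
# `𝔅 = ⋃_j Λ_j` — the all-blocks geometry `geoBK i` keyed by the block map `Δ(·)` itself (`blkOf`), with the same rate; NO section of the carrier-index
# map `β` is used (the section-free twin of lit-balaban-p33's FILE 7b-B `B9Cor36SiteSandwichTransfer` §2–§4, for EVERY member including the cornered ones)

T. Bałaban, *Propagators for lattice gauge theories in a background field*, Commun. Math. Phys. **99** (1985) 389–434 [`Balaban1985BackgroundPropagators`, "B9"]
(held `paper:balaban1985-cmp99-background-propagators`; journal page = PDF page + 388); [4] = T. Bałaban, *Propagators and renormalization transformations for
lattice gauge theories. II*, Commun. Math. Phys. **96** (1984) 223–250 [`Balaban1984PropagatorsII`].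

statement-level skeleton of published theorems with citation tags; proofs where landed; nothing here is a claim about the Yang–Mills mass gap

THE PRINTED LOCUS (verbatim).  Cor. 3.6 p. 408 l. 1–14 («the operators G_□(U), G′_□(U) … satisfy (3.42)–(3.47) for x, y, y′ ∈ □̃»; «all the results of these
theorems are gauge invariant, so they hold for the configuration U also»); (3.89) p. 409 («for x ∈ Δ(y), supp λ ⊂ Δ(y′), y, y′ ∈ □» — read in the MEMBER's blocks);
(3.42) p. 397 («for x ∈ Δ(y), y ∈ Λ_j, supp λ ⊂ Δ(y′) … y, y′ ∈ 𝔅»); p. 393 l. 12–18 («Ω_j∖Ω_{j+1} = Bʲ(Λ_j), hence Λ_j ⊂ T^{(j)}_{Lʲη}» — every level set is a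
union of complete j-blocks, indexed by the points of `𝔅 = ⋃_j Λ_j`); [4] (2.51)–(2.55) p. 232 («|(Tλ)(x)| ≦ K(y,y′)|λ|», «this property is preserved under the
composition of operators possessing it»), (2.45)–(2.46) p. 231 (the blocks and their distance `d(y, y′)`).

WHY THIS FILE (pub-ymgap node N06 [B9], rows 18 of the N06 certificate; LOCATED-28 of 2026-08-30).  Lit-balaban-p33's FILE 7b-B transfers a cube-side
majorant (over r05's cube-sequence geometry `toB6 (geoCK i □)`, block map `Δ_□(·) = blkCubeY i □`) to node00-def-Y's INDEX-keyed member geometry `toB6 (geo9K i)`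
(carrier = index bonds, block map `(z, j) ↦ ιB(Δ(z))` through a SECTION `ιB` of the carrier-block map `β`, `β ∘ ιB = id`).  At the CORNERED members of the
record's family `β` is not onto (`Node00.MemberYCornered.not_forall_memberY_beta_section`), so no section exists and that currency is silent there; the
all-members rows-18 supply of the N06 certificate therefore reads the (3.42) block majorants over the ALL-BLOCKS geometry `geoBK i` of
`B9SectBAllBlocksGeometryY` (sites = ALL blocks `𝔅`, `dist = d_T` of [4] (2.46), `len(Δ) = L^{j(Δ)}η`), keyed by `blkOf` — print's own indexing «y, y′ ∈ 𝔅»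
(dag-n06-c `B9Local342OfBlocksXSK` ∕ `B9BlockKeyTransferXSK` consume exactly this key).  THIS FILE is FILE 7b-B's §2–§4 in that key.  The proof is p33's
VERBATIM with the section deleted: the one geometric fact used — a source block `Δ(y′)` carrying a site near □ IS a cube block — is r05's section-free
`cube_blkOf_eq_of_blkOf_eq_of_nearH` (p33's wrapper `blkCubeY_eq_of_blkOf_eq_of_nearH` BY NAME), and the two coarsening comparisons (levels only grow, distances
only shrink) are read at `blkOf` directly (`geoBK`'s length and distance ARE the block's `L^{j}η` and `d_T`):
* §1 the all-blocks geometry read at sites: `geoBK_len_blkOf`, `geoBK_dist_blkOf`; the comparisons `len_cube_le_len_block`, `dist_block_le_dist_cube`;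
* §2 ★★★ `hasMajorant_conj_site_sandwich_blocks` — GENERIC (p33's §3 re-keyed): `conj b M ≺ K_C` over `toB6 (geoCK i □)`, `|g₁| ≤ G₁(Δ_□(·))`,
  `|g₂| ≤ G₂(Δ_□(·))` with `supp g₂` near □, `u` bi-contractive, `K ≥ 0` on blocks dominating `G₁(Δ_□x)·K_C(Δ_□x, Δ_□x₀)·G₂(Δ_□x₀)` at active sources ⟹
  `conj b(M_{g₁}R(u)⁻¹MR(u)M_{g₂}) ≺ (M₂Σ_j‖b_j‖)²·K` over `toB6 (geoBK i)` keyed by `blkOf`;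
* §3 ★★ `hasMajorant_conj_site_sandwich_decay_blocks`, ★★ `hasMajorant_conj_site_sandwich_decay_src_blocks` — the two shapes of record (p33's §4 re-keyed).

HONEST SCOPE / NOT CLAIMED.  Finite bookkeeping; NO estimate of [B9] is proved (the cube-side majorant `hM` is a HYPOTHESIS — r05's `gp_cube_entries_at_locCfg`
supplies it).  «Cornered members» are OUR bookkeeping (print's [B7] (4) p. 18 ∕ [B9] p. 393 assume complete blocks level by level, where the all-blocks key and the
index key coincide — lit-balaban OWNER WORD IR-N06-SECTION 2026-08-30: consumer-side object); nothing printed is altered.  Inhabited exactly as p33's: `g₂ := 0` gives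
`0 ≺ K`; at `g₁ = g₂ = 1`-near-□, `u = 1` it is r05's `majorant_transfer_of_nearH` through coordinates.  Count-neutral; rows 18 NOT thereby derived; N06 NOT
discharged; nothing on `d = 4`, the continuum, reflection positivity, the mass gap or Clay.  No `sorry`, no `axiom`, no `… : Prop` fact, no `instance`, no
`notation`, no `def`.  NEW file; nothing landed is modified.  Cell `pub-ymgap` (D-0062), seat `pub-ymgap-dag-n06-c` (gen 23), 2026-08-30; `--supports
stmt-QuantumFields-27364`.  Net new unproved facts: 0.

RELATED IN THE TREE, NOT DUPLICATED (searched 2026-08-30, `rg` over `lean/Literature` + `lean/Summits` for the basename and every decl name: 0 hits): p33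
`B9Cor36SiteSandwichTransfer` (index-keyed through `ιB`; §1 row-local rules and `blkCubeY_eq_of_blkOf_eq_of_nearH` USED BY NAME), r05 `B9CubeCoarsening`
(`geomT_dist_coarsen_le`, `coarsen_blkOf` BY NAME), dag-n06-c `B9SectBAllBlocksGeometryY` (`geoBK`), `B9BlockKeyTransferXSK` (the opposite bookkeeping
direction block-keyed ⟹ index-keyed at the record).
-/

noncomputable section

namespace Literature.MathematicalPhysics.QuantumFieldTheory.Balaban1983to89.B9Cor36SiteSandwichTransferBlocks

open Literature.MathematicalPhysics.QuantumFieldTheory.Balaban1983to89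
open Literature.MathematicalPhysics.QuantumFieldTheory.Balaban1983to89.B6RandomWalk (HasMajorant BlockSupp hasMajorant_mono)
open Literature.MathematicalPhysics.QuantumFieldTheory.Balaban1983to89.B9Thm34Ext (toB6)
open Literature.MathematicalPhysics.QuantumFieldTheory.Balaban1983to89.B9Ineq347 (ScaleTransfer)
open Literature.MathematicalPhysics.QuantumFieldTheory.Balaban1983to89.B9Eq39Adjoint (R R_zero R_smul)
open Literature.MathematicalPhysics.QuantumFieldTheory.Balaban1983to89.B9Eq352DivFormLetters (conj conj_apply coordEquiv coordEquiv_apply coordEquiv_symm_apply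
  norm_coordSymm_apply_le)
open Literature.MathematicalPhysics.QuantumFieldTheory.Balaban1983to89.B6KLevelCensusIndexV1 (KIdx kGeo)
open Literature.MathematicalPhysics.QuantumFieldTheory.Balaban1983to89.B6Cover236MultiLevelBlocks (cubes)
open Literature.MathematicalPhysics.QuantumFieldTheory.Balaban1983to89.B6Geom246MultiLevelBox (bset blkOf blkOf_val)
open Literature.MathematicalPhysics.QuantumFieldTheory.Balaban1983to89.B6Geom246MultiLevelTorus (geomT bondT)
open Literature.MathematicalPhysics.QuantumFieldTheory.Balaban1983to89.B9CubeSequence408 (NearH lev_cubeFam_le)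
open Literature.MathematicalPhysics.QuantumFieldTheory.Balaban1983to89.B9CubeCoarsening (coarsen_blkOf geomT_dist_coarsen_le)
open Literature.MathematicalPhysics.QuantumFieldTheory.Balaban1983to89.B9CubeLettersOpsL0 (cubeFamY levCubeY)
open Literature.MathematicalPhysics.QuantumFieldTheory.Balaban1983to89.B9CubeLettersBondOpsL0 (BlkCubeY)
open Literature.MathematicalPhysics.QuantumFieldTheory.Balaban1983to89.B9Eq360DeltaPrimeACubeY (blkCubeY blkCubeY_apply)
open Literature.MathematicalPhysics.QuantumFieldTheory.Balaban1983to89.B9CubeGeometryInputs (geoCK geoCK_len geoCK_eta geoCK_eta_pos geoCK_len_pos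
  geoCK_len_blkCubeY geoCK_dist_axioms)
open Literature.MathematicalPhysics.QuantumFieldTheory.Balaban1983to89.B9Thm37CubeCoverCommutators (cutMulY cutMulY_apply)
open Literature.MathematicalPhysics.QuantumFieldTheory.Balaban1983to89.B9Cor36CinvCubeLocLetterMajorant (norm_le_sum_mul_of_repr_le)
open Literature.MathematicalPhysics.QuantumFieldTheory.Balaban1983to89.B9Cor36SiteSandwichTransfer (blkCubeY_eq_of_blkOf_eq_of_nearH)
open Literature.MathematicalPhysics.QuantumFieldTheory.Balaban1983to89.B9SectBAllBlocksGeometryY (geoBK geoBK_len geoBK_len_pos geoBK_dist_nonneg)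
open Literature.MathematicalPhysics.QuantumFieldTheory.Balaban1983to89.Node00 (SiteY BlkY CfgY conjY conjY_apply toKT levY)

variable {d ℓ : ℕ} {hd : 1 ≤ d + 1} {hL : Odd (ℓ + 1) ∧ 1 < ℓ + 1} {b₀ b₁ : ℝ}
variable {𝔸 : Type} [NormedRing 𝔸] [NormedAlgebra ℂ 𝔸] [CompleteSpace 𝔸]
variable {ι : Type} [Fintype ι]

/-! ## §1  The all-blocks geometry read at sites; coarsening comparisons with the cube sequence's geometry (no section) -/

section BlockGeometry

variable (i : KIdx d ℓ hd hL b₀ b₁) (c : ↥(cubes (toKT i).D.toDomains))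

/-- the (3.41) length of the block of `z` in the all-blocks geometry: `L^{lev z}·η`. [cite: Balaban1985BackgroundPropagators, (3.41) p.397; Balaban1984PropagatorsII, (2.1) p.224] -/
theorem geoBK_len_blkOf (z : SiteY i) : (geoBK i).len (blkOf i.D.toDomains z) = ((ℓ : ℝ) + 1) ^ levY i z * (kGeo i).eta := by
  rw [geoBK_len, blkOf_val]
  push_cast
  rfl

/-- the (2.46) distance of the all-blocks geometry at blocks of sites is `d_T` of the blocks (by definition). [cite: Balaban1984PropagatorsII, (2.46) p.231, dictionary] -/
theorem geoBK_dist_blkOf (z w : SiteY i) :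
    (geoBK i).dist (blkOf i.D.toDomains z) (blkOf i.D.toDomains w) = (geomT i.D).dist (blkOf i.D.toDomains z) (blkOf i.D.toDomains w) := rfl

/-- **LEVELS ONLY GROW UNDER COARSENING**, all-blocks reading: `ℓ_□(Δ_□(z)) ≤ ℓ(Δ(z))`. [cite: Balaban1985BackgroundPropagators, p.408 (Ω_n(□) ⊂ Ω_n); Balaban1984PropagatorsII, (2.1) p.224] -/
theorem len_cube_le_len_block (z : SiteY i) : (geoCK i c).len (blkCubeY i c z) ≤ (geoBK i).len (blkOf i.D.toDomains z) := by
  rw [(geoCK_len_blkCubeY i c z).1, geoBK_len_blkOf i]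
  have hη : 0 < (kGeo i).eta := by rw [← geoCK_eta i c]; exact geoCK_eta_pos i c
  have hL1 : (1 : ℝ) ≤ (ℓ : ℝ) + 1 := by linarith [(Nat.cast_nonneg ℓ : (0 : ℝ) ≤ ℓ)]
  exact mul_le_mul_of_nonneg_right (pow_le_pow_right₀ hL1 (lev_cubeFam_le z.1)) hη.le

/-- **DISTANCES ONLY SHRINK UNDER COARSENING**, all-blocks reading: `d(Δ(z), Δ(w)) ≤ d_□(Δ_□(z), Δ_□(w))` (r05's `geomT_dist_coarsen_le`).
[cite: Balaban1984PropagatorsII, (2.46) p.231; Balaban1985BackgroundPropagators, (3.89) p.409] -/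
theorem dist_block_le_dist_cube (z w : SiteY i) :
    (geoBK i).dist (blkOf i.D.toDomains z) (blkOf i.D.toDomains w) ≤ (geoCK i c).dist (blkCubeY i c z) (blkCubeY i c w) := by
  rw [geoBK_dist_blkOf i]
  have h := geomT_dist_coarsen_le (D := (toKT i).D) (q := c) (hL := hL.1) (hM := B9CubeLettersOpsL0.oddMh i) (toKT i).hMh (toKT i).hP
    (blkCubeY i c z) (blkCubeY i c w)
  rw [blkCubeY_apply, blkCubeY_apply] at h
  unfold cubeFamY at h
  rw [coarsen_blkOf, coarsen_blkOf] at h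
  exact h

end BlockGeometry

/-! ## §2  ★★★ The sandwich transfer: cube-sequence blocks → ALL the member's blocks, keyed by `blkOf` (no section) -/

section Transfer

variable (i : KIdx d ℓ hd hL b₀ b₁) (c : ↥(cubes (toKT i).D.toDomains)) (b : Module.Basis ι ℝ 𝔸)

omit [CompleteSpace 𝔸] in
/-- ★★★ **THE SITE-SECTOR SANDWICH TRANSFER, ALL-BLOCKS KEY.**  Let `M` be an `ℝ`-linear operator on the `𝔸`-valued site functions whose coordinate conjugate has
the block majorant `K_C` over the cube sequence's geometry `toB6 (geoCK i □)`; let `u` be a bi-contractive site gauge, `g₁, g₂` real multipliers with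
`|g₁(z)| ≤ G₁(Δ_□(z))`, `|g₂(z)| ≤ G₂(Δ_□(z))` and `g₂` supported near □ (`NearH`); let `K ≥ 0` be a kernel on the member's BLOCKS dominating
`G₁(Δ_□x)·K_C(Δ_□x, Δ_□x₀)·G₂(Δ_□x₀)` for every row site `x` and every active source site `x₀` (`g₂(x₀) ≠ 0`).  Then over the all-blocks geometry
`toB6 (geoBK i)` (block map `(z, j) ↦ Δ(z)`): `conj b (M_{g₁}·R(u)⁻¹·M·R(u)·M_{g₂}) ≺ (M₂Σ_j‖b_j‖)²·K`.  (A source in the member block `Δ(y′)` is cut to `supp g₂` —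
empty, or `Δ(y′)` has a site near □ and IS a cube block — rotated at no cost, its coordinates bounded by `M₂Σ‖b‖·G₂·|source|`; `M` maps it under `K_C(·, Δ_□(x₀))`;
the row factor costs `G₁(Δ_□x)·M₂Σ‖b‖`.)  Section-free twin of p33's `hasMajorant_conj_site_sandwich`, valid at every member.
[cite: Balaban1985BackgroundPropagators, Cor. 3.6 p.408 l.1–14, (3.89) p.409, (3.42) p.397 («y, y′ ∈ 𝔅»), (3.28)–(3.33) pp.395–396; Balaban1984PropagatorsII, (2.51)–(2.55) p.232, (2.45)–(2.46) p.231] -/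
theorem hasMajorant_conj_site_sandwich_blocks {M₂ : ℝ} (hM₂ : 0 ≤ M₂) (hrepr : ∀ (v : 𝔸) (j : ι), |b.repr v j| ≤ M₂ * ‖v‖)
    (γ : SiteY i → 𝔸ˣ) (hγ : ∀ z a, ‖R (γ z) a‖ ≤ ‖a‖ ∧ ‖R (γ z)⁻¹ a‖ ≤ ‖a‖)
    (g₁ g₂ : SiteY i → ℝ) (G₁ G₂ : BlkCubeY i c → ℝ) (hG₁ : ∀ z, |g₁ z| ≤ G₁ (blkCubeY i c z)) (hG₂ : ∀ z, |g₂ z| ≤ G₂ (blkCubeY i c z))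
    (hnear : ∀ z, g₂ z ≠ 0 → NearH c z.1)
    (Rr : ℝ) (H : Prop) [Fintype (geoBK i).Site] (Rr' : ℝ) (Hp : Prop)
    {KC : BlkCubeY i c → BlkCubeY i c → ℝ} {K : (geoBK i).Site → (geoBK i).Site → ℝ} (hK : ∀ a a', 0 ≤ K a a')
    (hcmp : ∀ x x₀ : SiteY i, g₂ x₀ ≠ 0 →
      G₁ (blkCubeY i c x) * KC (blkCubeY i c x) (blkCubeY i c x₀) * G₂ (blkCubeY i c x₀) ≤ K (blkOf i.D.toDomains x) (blkOf i.D.toDomains x₀))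
    (M : Module.End ℝ (SiteY i → 𝔸)) (hM : HasMajorant (g := toB6 (geoCK i c) Rr H) (fun p : SiteY i × ι => blkCubeY i c p.1) (conj b M) KC) :
    HasMajorant (g := toB6 (geoBK i) Rr' Hp) (fun p : SiteY i × ι => blkOf i.D.toDomains p.1)
      (conj b ((cutMulY (𝔸 := 𝔸) g₁).restrictScalars ℝ ∘ₗ (conjY γ⁻¹).restrictScalars ℝ ∘ₗ M ∘ₗ (conjY γ).restrictScalars ℝ ∘ₗ
        (cutMulY (𝔸 := 𝔸) g₂).restrictScalars ℝ))
      (fun a a' => (M₂ * ∑ j, ‖b j‖) ^ 2 * K a a') := by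
  intro y' μ B hμ x
  have hSb : 0 ≤ ∑ j, ‖b j‖ := Finset.sum_nonneg fun _ _ => norm_nonneg _
  have hKB : 0 ≤ (M₂ * ∑ j, ‖b j‖) ^ 2 * K (blkOf i.D.toDomains x.1) y' * B := mul_nonneg (mul_nonneg (sq_nonneg _) (hK _ _)) hμ.nonneg
  -- the source as an `𝔸`-valued function, cut and rotated
  set lam : SiteY i → 𝔸 := (coordEquiv b).symm μ with hlam
  set ν : SiteY i → 𝔸 := conjY γ (cutMulY g₂ lam) with hν
  rw [conj_apply]
  simp only [LinearMap.comp_apply, LinearMap.restrictScalars_apply]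
  rw [← hlam]
  change |b.repr (cutMulY g₁ (conjY γ⁻¹ (M ν)) x.1) x.2| ≤ (M₂ * ∑ j, ‖b j‖) ^ 2 * K (blkOf i.D.toDomains x.1) y' * B
  rw [cutMulY_apply, conjY_apply, Pi.inv_apply]
  -- the row factor: `|repr (g₁(x)·R(γ(x))⁻¹ a)| ≤ M₂·|g₁ x|·‖a‖`
  have hrowfac : |b.repr ((((g₁ x.1 : ℝ) : ℂ)) • R (γ x.1)⁻¹ (M ν x.1)) x.2| ≤ M₂ * (G₁ (blkCubeY i c x.1) * ‖M ν x.1‖) := by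
    refine (hrepr _ _).trans (mul_le_mul_of_nonneg_left ?_ hM₂)
    rw [norm_smul, Complex.norm_real, Real.norm_eq_abs]
    exact mul_le_mul (hG₁ x.1) ((hγ x.1 _).2) (norm_nonneg _) ((abs_nonneg _).trans (hG₁ x.1))
  -- the source: every value of `lam` is bounded by `(Σ‖b‖)·B`, and `lam` vanishes off the member block `y′`
  have hlam_bd : ∀ w, ‖lam w‖ ≤ (∑ j, ‖b j‖) * B := fun w => by
    by_cases hw : blkOf i.D.toDomains w = y'
    · rw [hlam]; exact norm_coordSymm_apply_le b μ w B fun j => hμ.bound (w, j) hw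
    · have h0 : lam w = 0 := by
        rw [hlam, coordEquiv_symm_apply]
        exact Finset.sum_eq_zero fun j _ => by rw [hμ.off (w, j) hw, zero_smul]
      rw [h0, norm_zero]; exact mul_nonneg hSb hμ.nonneg
  have hlam_off : ∀ w, blkOf i.D.toDomains w ≠ y' → lam w = 0 := fun w hw => by
    rw [hlam, coordEquiv_symm_apply]
    exact Finset.sum_eq_zero fun j _ => by rw [hμ.off (w, j) hw, zero_smul]
  have hν_val : ∀ w, ν w = R (γ w) ((((g₂ w : ℝ) : ℂ)) • lam w) := fun w => by rw [hν, conjY_apply, cutMulY_apply]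
  -- either `ν = 0`, or there is an active source site `w₀` (then near □, in the member block `y′`)
  by_cases hex : ∃ w₀, g₂ w₀ ≠ 0 ∧ lam w₀ ≠ 0
  swap
  · have hν0 : ν = 0 := funext fun w => by
      rw [hν_val]
      by_cases h2 : g₂ w = 0
      · rw [h2, Complex.ofReal_zero, zero_smul, R_zero]; rfl
      · have hl : lam w = 0 := by
          by_contra hl; exact hex ⟨w, h2, hl⟩
        rw [hl, smul_zero, R_zero]; rfl
    rw [hν0, map_zero, Pi.zero_apply, R_zero, smul_zero, map_zero, Finsupp.zero_apply, abs_zero]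
    exact hKB
  obtain ⟨w₀, hg₂w₀, hlamw₀⟩ := hex
  have hy' : blkOf i.D.toDomains w₀ = y' := by
    by_contra h; exact hlamw₀ (hlam_off w₀ h)
  have hw₀near : NearH c w₀.1 := hnear w₀ hg₂w₀
  set s₀ : BlkCubeY i c := blkCubeY i c w₀ with hs₀
  have hG₂0 : 0 ≤ G₂ s₀ := (abs_nonneg _).trans (hG₂ w₀)
  -- sites carrying the source lie in the cube block `s₀` (a member block with a site near □ IS a cube block — section-free)
  have hblk : ∀ w, lam w ≠ 0 → blkCubeY i c w = s₀ := fun w hw => by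
    have h1 : blkOf i.D.toDomains w = y' := by
      by_contra h; exact hw (hlam_off w h)
    exact blkCubeY_eq_of_blkOf_eq_of_nearH i c hw₀near (h1.trans hy'.symm)
  -- the coordinates of `ν`: a source over the cube geometry supported in `s₀`
  have hνsupp : BlockSupp (g := toB6 (geoCK i c) Rr H) (fun p : SiteY i × ι => blkCubeY i c p.1) (coordEquiv b ν) s₀
      (M₂ * (G₂ s₀ * ((∑ j, ‖b j‖) * B))) := by
    refine ⟨mul_nonneg hM₂ (mul_nonneg hG₂0 (mul_nonneg hSb hμ.nonneg)), fun p hp => ?_, fun p hp => ?_⟩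
    · rw [coordEquiv_apply]
      refine (hrepr _ _).trans (mul_le_mul_of_nonneg_left ?_ hM₂)
      rw [hν_val]
      refine ((hγ p.1 _).1).trans ?_
      rw [norm_smul, Complex.norm_real, Real.norm_eq_abs]
      have hp' : blkCubeY i c p.1 = s₀ := hp
      exact mul_le_mul ((hG₂ p.1).trans (by rw [hp'])) (hlam_bd p.1) (norm_nonneg _) hG₂0
    · rw [coordEquiv_apply]
      have hl : lam p.1 = 0 := by
        by_contra hl; exact hp (hblk p.1 hl)
      rw [hν_val, hl, smul_zero, R_zero, map_zero, Finsupp.zero_apply]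
  -- the cube-side majorant on that source, read at the rows `(x.1, j′)`
  have hrow : ∀ j', |b.repr (M ν x.1) j'| ≤ KC (blkCubeY i c x.1) s₀ * (M₂ * (G₂ s₀ * ((∑ j, ‖b j‖) * B))) := fun j' => by
    have h := hM s₀ (coordEquiv b ν) _ hνsupp (x.1, j')
    rwa [conj_apply, LinearEquiv.symm_apply_apply] at h
  have hnorm : ‖M ν x.1‖ ≤ (∑ j, ‖b j‖) * (KC (blkCubeY i c x.1) s₀ * (M₂ * (G₂ s₀ * ((∑ j, ‖b j‖) * B)))) :=
    norm_le_sum_mul_of_repr_le b _ hrow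
  have hc := hcmp x.1 w₀ hg₂w₀
  rw [hy'] at hc
  have hG₁0 : 0 ≤ G₁ (blkCubeY i c x.1) := (abs_nonneg _).trans (hG₁ x.1)
  calc |b.repr ((((g₁ x.1 : ℝ) : ℂ)) • R (γ x.1)⁻¹ (M ν x.1)) x.2| ≤ M₂ * (G₁ (blkCubeY i c x.1) * ‖M ν x.1‖) := hrowfac
    _ ≤ M₂ * (G₁ (blkCubeY i c x.1) * ((∑ j, ‖b j‖) * (KC (blkCubeY i c x.1) s₀ * (M₂ * (G₂ s₀ * ((∑ j, ‖b j‖) * B)))))) :=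
        mul_le_mul_of_nonneg_left (mul_le_mul_of_nonneg_left hnorm hG₁0) hM₂
    _ = (M₂ * ∑ j, ‖b j‖) ^ 2 * (G₁ (blkCubeY i c x.1) * KC (blkCubeY i c x.1) (blkCubeY i c w₀) * G₂ (blkCubeY i c w₀)) * B := by
        rw [hs₀]; ring
    _ ≤ (M₂ * ∑ j, ‖b j‖) ^ 2 * K (blkOf i.D.toDomains x.1) y' * B :=
        mul_le_mul_of_nonneg_right (mul_le_mul_of_nonneg_left hc (sq_nonneg _)) hμ.nonneg

end Transfer

/-! ## §3  The shapes of record: decaying cube-side kernels with length weights, all-blocks key -/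

section Decay

variable (i : KIdx d ℓ hd hL b₀ b₁) (c : ↥(cubes (toKT i).D.toDomains)) (b : Module.Basis ι ℝ 𝔸)

omit [CompleteSpace 𝔸] in
/-- ★★ **THE SANDWICH TRANSFER FOR `K_C = B·ℓ_□(a)ⁿ·e^{−δd_□(a,a′)}`, ROW MULTIPLIER `|g₁| ≤ c₁·ℓ_□⁻ᵐ` (`m ≤ n`), CUT-OFF `|g₂| ≤ c₂` NEAR □, ALL-BLOCKS KEY**:
`conj b (M_{g₁}R(u)⁻¹MR(u)M_{g₂}) ≺ (M₂Σ‖b‖)²c₁c₂B·ℓ(a)^{n−m}·e^{−δd(a,a′)}` over `toB6 (geoBK i)` keyed by `blkOf` — levels only grow and distances only shrink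
under coarsening, so the cube-currency bound dominates the all-blocks one (r05's p. 409 reading).  Section-free twin of p33's `…_decay`.
[cite: Balaban1985BackgroundPropagators, Cor. 3.6 p.408, (3.89) p.409, Thm 3.1 (3.42) p.397; Balaban1984PropagatorsII, (2.51) p.232, (2.46) p.231] -/
theorem hasMajorant_conj_site_sandwich_decay_blocks {M₂ : ℝ} (hM₂ : 0 ≤ M₂) (hrepr : ∀ (v : 𝔸) (j : ι), |b.repr v j| ≤ M₂ * ‖v‖)
    (γ : SiteY i → 𝔸ˣ) (hγ : ∀ z a, ‖R (γ z) a‖ ≤ ‖a‖ ∧ ‖R (γ z)⁻¹ a‖ ≤ ‖a‖)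
    (g₁ g₂ : SiteY i → ℝ) {c₁ c₂ : ℝ} (hc₁ : 0 ≤ c₁) (hc₂ : 0 ≤ c₂) {m n : ℕ} (hmn : m ≤ n)
    (hg₁ : ∀ z, |g₁ z| * (geoCK i c).len (blkCubeY i c z) ^ m ≤ c₁) (hg₂ : ∀ z, |g₂ z| ≤ c₂) (hnear : ∀ z, g₂ z ≠ 0 → NearH c z.1)
    (Rr : ℝ) (H : Prop) [Fintype (geoBK i).Site] (Rr' : ℝ) (Hp : Prop)
    {B δ : ℝ} (hB : 0 ≤ B) (hδ : 0 ≤ δ) (M : Module.End ℝ (SiteY i → 𝔸))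
    (hM : HasMajorant (g := toB6 (geoCK i c) Rr H) (fun p : SiteY i × ι => blkCubeY i c p.1) (conj b M)
      (fun a a' => B * (geoCK i c).len a ^ n * Real.exp (-(δ * (geoCK i c).dist a a')))) :
    HasMajorant (g := toB6 (geoBK i) Rr' Hp) (fun p : SiteY i × ι => blkOf i.D.toDomains p.1)
      (conj b ((cutMulY (𝔸 := 𝔸) g₁).restrictScalars ℝ ∘ₗ (conjY γ⁻¹).restrictScalars ℝ ∘ₗ M ∘ₗ (conjY γ).restrictScalars ℝ ∘ₗ
        (cutMulY (𝔸 := 𝔸) g₂).restrictScalars ℝ))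
      (fun a a' => (M₂ * ∑ j, ‖b j‖) ^ 2 * (c₁ * c₂ * B) * (geoBK i).len a ^ (n - m) * Real.exp (-(δ * (geoBK i).dist a a'))) := by
  have hlenpos : ∀ z, 0 < (geoCK i c).len (blkCubeY i c z) := fun z => geoCK_len_pos i c _
  refine hasMajorant_mono (g := toB6 (geoBK i) Rr' Hp) _
    (hasMajorant_conj_site_sandwich_blocks i c b hM₂ hrepr γ hγ g₁ g₂ (fun s => c₁ * ((geoCK i c).len s ^ m)⁻¹) (fun _ => c₂)
      (fun z => ?_) hg₂ hnear Rr H Rr' Hp (K := fun a a' => (c₁ * c₂ * B) * (geoBK i).len a ^ (n - m) * Real.exp (-(δ * (geoBK i).dist a a')))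
      (fun a a' => ?_) (fun x x₀ _ => ?_) M hM)
    fun a a' => le_of_eq (by ring)
  · -- `|g₁ z| ≤ c₁·ℓ_□(Δ_□z)⁻ᵐ`
    have hp := pow_pos (hlenpos z) m
    rw [← div_eq_mul_inv, le_div_iff₀ hp]
    exact hg₁ z
  · exact mul_nonneg (mul_nonneg (mul_nonneg (mul_nonneg hc₁ hc₂) hB) (pow_nonneg (geoBK_len_pos i a).le _)) (Real.exp_nonneg _)
  · -- the comparison at the row `x` and the active source `x₀`
    have hlx := hlenpos x
    have hLC := len_cube_le_len_block i c x
    have hdD := dist_block_le_dist_cube i c x x₀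
    have hpow : (geoCK i c).len (blkCubeY i c x) ^ n * ((geoCK i c).len (blkCubeY i c x) ^ m)⁻¹ = (geoCK i c).len (blkCubeY i c x) ^ (n - m) := by
      rw [pow_sub₀ _ hlx.ne' hmn]
    have hexp : Real.exp (-(δ * (geoCK i c).dist (blkCubeY i c x) (blkCubeY i c x₀))) ≤
        Real.exp (-(δ * (geoBK i).dist (blkOf i.D.toDomains x) (blkOf i.D.toDomains x₀))) :=
      Real.exp_le_exp.2 (by nlinarith)
    have hpw : (geoCK i c).len (blkCubeY i c x) ^ (n - m) ≤ (geoBK i).len (blkOf i.D.toDomains x) ^ (n - m) :=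
      pow_le_pow_left₀ hlx.le hLC _
    calc c₁ * ((geoCK i c).len (blkCubeY i c x) ^ m)⁻¹ * (B * (geoCK i c).len (blkCubeY i c x) ^ n *
          Real.exp (-(δ * (geoCK i c).dist (blkCubeY i c x) (blkCubeY i c x₀)))) * c₂
        = (c₁ * c₂ * B) * ((geoCK i c).len (blkCubeY i c x) ^ n * ((geoCK i c).len (blkCubeY i c x) ^ m)⁻¹) *
          Real.exp (-(δ * (geoCK i c).dist (blkCubeY i c x) (blkCubeY i c x₀))) := by ring
      _ = (c₁ * c₂ * B) * (geoCK i c).len (blkCubeY i c x) ^ (n - m) * Real.exp (-(δ * (geoCK i c).dist (blkCubeY i c x) (blkCubeY i c x₀))) := by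
          rw [hpow]
      _ ≤ (c₁ * c₂ * B) * (geoBK i).len (blkOf i.D.toDomains x) ^ (n - m) *
          Real.exp (-(δ * (geoBK i).dist (blkOf i.D.toDomains x) (blkOf i.D.toDomains x₀))) :=
          mul_le_mul (mul_le_mul_of_nonneg_left hpw (mul_nonneg (mul_nonneg hc₁ hc₂) hB)) hexp (Real.exp_nonneg _)
            (mul_nonneg (mul_nonneg (mul_nonneg hc₁ hc₂) hB) (pow_nonneg (geoBK_len_pos i _).le _))

omit [CompleteSpace 𝔸] in
/-- ★★ **THE SOURCE-WEIGHTED VARIANT, ALL-BLOCKS KEY** (the right cut-off derivative of (3.42)₃): `K_C = B·ℓ_□(a)²·e^{−δd_□}`, `|g₁| ≤ c₁`, `|g₂| ≤ c₂·ℓ_□⁻¹`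
near □, and ONE scale transfer of the cube geometry `e^{−αδd_□(a,a′)}ℓ_□(a′)⁻¹ ≤ Λ·ℓ_□(a)⁻¹` (p. 398 remark) ⟹ `≺ (M₂Σ‖b‖)²c₁c₂BΛ·ℓ(a)·e^{−(1−α)δd(a,a′)}` over
`toB6 (geoBK i)` keyed by `blkOf`.  Section-free twin of p33's `…_decay_src`.
[cite: Balaban1985BackgroundPropagators, Cor. 3.6 p.408, Thm 3.1 (3.42)₃ p.397, p.398 (remark after (3.47)); Balaban1984PropagatorsII, (2.51) p.232, (2.46) p.231] -/
theorem hasMajorant_conj_site_sandwich_decay_src_blocks {M₂ : ℝ} (hM₂ : 0 ≤ M₂) (hrepr : ∀ (v : 𝔸) (j : ι), |b.repr v j| ≤ M₂ * ‖v‖)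
    (γ : SiteY i → 𝔸ˣ) (hγ : ∀ z a, ‖R (γ z) a‖ ≤ ‖a‖ ∧ ‖R (γ z)⁻¹ a‖ ≤ ‖a‖)
    (g₁ g₂ : SiteY i → ℝ) {c₁ c₂ : ℝ} (hc₁ : 0 ≤ c₁) (hc₂ : 0 ≤ c₂)
    (hg₁ : ∀ z, |g₁ z| ≤ c₁) (hg₂ : ∀ z, |g₂ z| * (geoCK i c).len (blkCubeY i c z) ≤ c₂) (hnear : ∀ z, g₂ z ≠ 0 → NearH c z.1)
    (Rr : ℝ) (H : Prop) [Fintype (geoBK i).Site] (Rr' : ℝ) (Hp : Prop)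
    {B δ α Λ : ℝ} (hB : 0 ≤ B) (hδ : 0 ≤ δ) (hα1 : α ≤ 1) (hΛ : 0 ≤ Λ)
    (hST : ScaleTransfer (geoCK i c) δ α Λ (fun a => ((geoCK i c).len a)⁻¹))
    (M : Module.End ℝ (SiteY i → 𝔸))
    (hM : HasMajorant (g := toB6 (geoCK i c) Rr H) (fun p : SiteY i × ι => blkCubeY i c p.1) (conj b M)
      (fun a a' => B * (geoCK i c).len a ^ 2 * Real.exp (-(δ * (geoCK i c).dist a a')))) :
    HasMajorant (g := toB6 (geoBK i) Rr' Hp) (fun p : SiteY i × ι => blkOf i.D.toDomains p.1)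
      (conj b ((cutMulY (𝔸 := 𝔸) g₁).restrictScalars ℝ ∘ₗ (conjY γ⁻¹).restrictScalars ℝ ∘ₗ M ∘ₗ (conjY γ).restrictScalars ℝ ∘ₗ
        (cutMulY (𝔸 := 𝔸) g₂).restrictScalars ℝ))
      (fun a a' => (M₂ * ∑ j, ‖b j‖) ^ 2 * (c₁ * c₂ * B * Λ) * (geoBK i).len a * Real.exp (-((1 - α) * δ * (geoBK i).dist a a'))) := by
  have hlenpos : ∀ z, 0 < (geoCK i c).len (blkCubeY i c z) := fun z => geoCK_len_pos i c _
  have hdnn := (geoCK_dist_axioms i c Rr H).1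
  refine hasMajorant_mono (g := toB6 (geoBK i) Rr' Hp) _
    (hasMajorant_conj_site_sandwich_blocks i c b hM₂ hrepr γ hγ g₁ g₂ (fun _ => c₁) (fun s => c₂ * ((geoCK i c).len s)⁻¹)
      hg₁ (fun z => ?_) hnear Rr H Rr' Hp
      (K := fun a a' => (c₁ * c₂ * B * Λ) * (geoBK i).len a * Real.exp (-((1 - α) * δ * (geoBK i).dist a a')))
      (fun a a' => ?_) (fun x x₀ _ => ?_) M hM)
    fun a a' => le_of_eq (by ring)
  · rw [← div_eq_mul_inv, le_div_iff₀ (hlenpos z)]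
    exact hg₂ z
  · exact mul_nonneg (mul_nonneg (mul_nonneg (mul_nonneg (mul_nonneg hc₁ hc₂) hB) hΛ) (geoBK_len_pos i a).le) (Real.exp_nonneg _)
  · have hlx := hlenpos x
    have hLC := len_cube_le_len_block i c x
    have hdD := dist_block_le_dist_cube i c x x₀
    set dC := (geoCK i c).dist (blkCubeY i c x) (blkCubeY i c x₀) with hdC
    -- the scale transfer moves the source weight `ℓ_□(x₀)⁻¹` to the row at the cost `Λ·e^{αδd_□}`
    have hT := hST (blkCubeY i c x) (blkCubeY i c x₀)
    have hsplit : Real.exp (-(δ * dC)) = Real.exp (-(α * δ * dC)) * Real.exp (-((1 - α) * δ * dC)) := by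
      rw [← Real.exp_add]; ring_nf
    have hexp : Real.exp (-((1 - α) * δ * dC)) ≤ Real.exp (-((1 - α) * δ * (geoBK i).dist (blkOf i.D.toDomains x) (blkOf i.D.toDomains x₀))) := by
      refine Real.exp_le_exp.2 ?_
      have h1 : 0 ≤ (1 - α) * δ := mul_nonneg (by linarith) hδ
      nlinarith
    have key : ((geoCK i c).len (blkCubeY i c x)) ^ 2 * Real.exp (-(δ * dC)) * ((geoCK i c).len (blkCubeY i c x₀))⁻¹ ≤
        Λ * (geoCK i c).len (blkCubeY i c x) * Real.exp (-((1 - α) * δ * dC)) := by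
      rw [hsplit]
      have h2 : Real.exp (-(α * δ * dC)) * ((geoCK i c).len (blkCubeY i c x₀))⁻¹ ≤ Λ * ((geoCK i c).len (blkCubeY i c x))⁻¹ := hT
      have hl2 : 0 ≤ (geoCK i c).len (blkCubeY i c x) ^ 2 * Real.exp (-((1 - α) * δ * dC)) := mul_nonneg (sq_nonneg _) (Real.exp_nonneg _)
      calc (geoCK i c).len (blkCubeY i c x) ^ 2 * (Real.exp (-(α * δ * dC)) * Real.exp (-((1 - α) * δ * dC))) * ((geoCK i c).len (blkCubeY i c x₀))⁻¹
          = ((geoCK i c).len (blkCubeY i c x) ^ 2 * Real.exp (-((1 - α) * δ * dC))) * (Real.exp (-(α * δ * dC)) * ((geoCK i c).len (blkCubeY i c x₀))⁻¹) := by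
            ring
        _ ≤ ((geoCK i c).len (blkCubeY i c x) ^ 2 * Real.exp (-((1 - α) * δ * dC))) * (Λ * ((geoCK i c).len (blkCubeY i c x))⁻¹) :=
            mul_le_mul_of_nonneg_left h2 hl2
        _ = Λ * (geoCK i c).len (blkCubeY i c x) * Real.exp (-((1 - α) * δ * dC)) := by
            field_simp
    have hpre : 0 ≤ c₁ * c₂ * B := mul_nonneg (mul_nonneg hc₁ hc₂) hB
    calc c₁ * (B * (geoCK i c).len (blkCubeY i c x) ^ 2 * Real.exp (-(δ * dC))) * (c₂ * ((geoCK i c).len (blkCubeY i c x₀))⁻¹)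
        = (c₁ * c₂ * B) * ((geoCK i c).len (blkCubeY i c x) ^ 2 * Real.exp (-(δ * dC)) * ((geoCK i c).len (blkCubeY i c x₀))⁻¹) := by ring
      _ ≤ (c₁ * c₂ * B) * (Λ * (geoCK i c).len (blkCubeY i c x) * Real.exp (-((1 - α) * δ * dC))) := mul_le_mul_of_nonneg_left key hpre
      _ = (c₁ * c₂ * B * Λ) * (geoCK i c).len (blkCubeY i c x) * Real.exp (-((1 - α) * δ * dC)) := by ring
      _ ≤ (c₁ * c₂ * B * Λ) * (geoBK i).len (blkOf i.D.toDomains x) *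
          Real.exp (-((1 - α) * δ * (geoBK i).dist (blkOf i.D.toDomains x) (blkOf i.D.toDomains x₀))) :=
          mul_le_mul (mul_le_mul_of_nonneg_left hLC (mul_nonneg hpre hΛ)) hexp (Real.exp_nonneg _)
            (mul_nonneg (mul_nonneg hpre hΛ) (geoBK_len_pos i _).le)

end Decay

end Literature.MathematicalPhysics.QuantumFieldTheory.Balaban1983to89.B9Cor36SiteSandwichTransferBlocks

end
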